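import Summits.BirchSwinnertonDyer.BirchSwinnertonDyer.Theorems.ByReductionTypeAtTwoTowerLayerNat
import HarnessLib

/-!
# The TOWER gap certificate with every kernel-side datum DECIDABLE on integer literals
# (route ByReductionTypeAtTwo, crux `OrdKatoHalfAtTwo`, item stmt-BirchSwinnertonDyer-19271;
# seat bsd-2adic-tower-1 GEN 2, part 9)

HONEST FRAMING (cell `bsd-2adic`, run/shared/lean/pub/bsd-2adic/, HUMAN RULINGS D-0036/D-0074): THEOREMS
ONLY; nothing asserted; no definition; no new named fact; closes nothing by itself.

Part 8 (`…TowerLayerNat.lean`) indexes the certificate by rational primes but still displays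
`padicValNat 2 (ℓ² − 1)` (in the sharp exponent) and `padicValInt ℓ Δ_min` (in the `C_ℓ = 1` clause);
`padicValNat` is defined by well-founded recursion and does not reduce under `decide`. This part trades
them for DIVISIBILITY CERTIFICATES on integer literals, which `decide` / `norm_num` close per curve:
* the sharp exponent becomes `2^{min(j', e_ℓ)}` for any `e : ℕ → ℕ` with `¬ 2^{e_ℓ + 4} ∣ ℓ² − 1`
  (`e_ℓ ≥ v₂(ℓ² − 1) − 3`; e.g. `e_ℓ = 0` for `ℓ ≡ ±3 (mod 8)`: check `¬ 16 ∣ ℓ² − 1`);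
* the parity clause becomes `ℓ^{k_ℓ} ∣ Δ_min ∧ ℓ^{k_ℓ+1} ∤ Δ_min ∧ 2 ∤ k_ℓ` for a supplied `k : ℕ → ℕ`.
Also the bookkeeping lemma `padicValNat_eq_of_eq_pow_mul` (`n = p^v · m`, `p ∤ m` ⇒ `v_p(n) = v`) for
files that prefer the part-8 shape. Doors: `towerGapAtTwo_of_layerSelmer_cert`,
`bsdp_two_/mazurMainConjecture_two_of_layerSelmer_cert_of_missingLowerBoundAt` (`Ш`-currency, rank `0`),
`katoHalfAt_two_of_layerSelmer_cert` (the item AT `W`, `λ`-road).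

CHECKLIST for an instance file `W = M.baseChange ℚ` (`M : WeierstrassCurve ℤ` a minimal model):
ellipticity + global minimality + `GoodOrd W 2` (X5 toolkits, as in every X5 instance); odd torsion
(`Additive.…not_dvd_torsionOrder_of_irr'` ∘ `X5.…irr_two_of_forall_cubic_ne`, a cubic with no root mod
some `ℓ`); `P`, `hP` (decide); `hΔ` from a factorisation `M.Δ = ± ∏ ℓ^{k_ℓ}` (`minimalDiscriminantInt_baseChange_int`);
`hC` per `ℓ ∈ P`: `4` (nothing) | multiplicative (`hasMultiplicativeReductionAtPrime_of_intModel`: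
`ℓ ∣ M.Δ`, `ℓ ∤ M.c₄`, decide) | + `k_ℓ` odd (decide) | `ℓ ∤ M.Δ` (decide); `he` (decide); `harith`
(`decide`/`norm_num`); and the TYPED certificates `hper₀`, `hlow`, `hup`, `hsha` (resp. `hrank`, `hlan`,
`hμan`) stay hypotheses of the class theorem, displayed for the OFFER.
-/

set_option autoImplicit false

noncomputable section

open scoped Classical MatrixGroups ModularForm

open NumberField IsDedekindDomain CongruenceSubgroup WeierstrassCurve Literature.NumberTheory.EllipticCurves
  Literature.NumberTheory.EllipticCurves.ModularForms Literature.NumberTheory.EllipticCurves.Rank1Residual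
  Literature.NumberTheory.EllipticCurves.Rank1Residual.Typed
  Literature.NumberTheory.EllipticCurves.Greenberg1999
  Summit.BirchSwinnertonDyer.Rank1Residual.X1.MuLambda
  Summit.BirchSwinnertonDyer.Rank1Residual.X1.MuPart
  Summit.BirchSwinnertonDyer.Rank1Residual.X1.ParitySqueeze
  Summit.BirchSwinnertonDyer.BirchSwinnertonDyer.Theorems.Rank1ResidualX1Defs
  Summit.BirchSwinnertonDyer.Rank1Residual.X5 Summit.BirchSwinnertonDyer.Rank1Residual.X5.O1
  Summit.BirchSwinnertonDyer.Rank1Residual.X5.TowerGap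
  Summit.BirchSwinnertonDyer.Rank1Residual

namespace Summit.BirchSwinnertonDyer.BirchSwinnertonDyer.Theorems.KatoHalfPinch

section Valuations

/-- **`v_p(n) = v` from a factorisation `n = p^v · m` with `p ∤ m`** (bookkeeping for instance files;
both hypotheses are `decide`/`norm_num` goals on literals). [folklore] -/
theorem padicValNat_eq_of_eq_pow_mul {p n v m : ℕ} [hp : Fact p.Prime] (h : n = p ^ v * m)
    (hm : ¬ p ∣ m) : padicValNat p n = v := by
  have hm0 : m ≠ 0 := by rintro rfl; exact hm (dvd_zero p)
  rw [h, padicValNat.mul (pow_ne_zero _ hp.out.ne_zero) hm0, padicValNat.prime_pow,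
    padicValNat.eq_zero_of_not_dvd hm, add_zero]

/-- **`v_p(z) = k` for an integer `z` from `p^k ∣ z` and `p^{k+1} ∤ z`.** [folklore] -/
theorem padicValInt_eq_of_dvd_of_not_dvd {p : ℕ} [hp : Fact p.Prime] {z : ℤ} {k : ℕ}
    (h1 : (p : ℤ) ^ k ∣ z) (h2 : ¬ (p : ℤ) ^ (k + 1) ∣ z) : padicValInt p z = k := by
  have hz : z ≠ 0 := by rintro rfl; exact h2 (dvd_zero _)
  have h1' : k ≤ padicValInt p z := ((padicValInt_dvd_iff k z).mp h1).resolve_left hz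
  refine le_antisymm ?_ h1'
  by_contra h
  exact h2 ((padicValInt_dvd_iff (k + 1) z).mpr (Or.inr (by omega)))

/-- **An upper bound for `v₂(ℓ² − 1) − 3` from one non-divisibility**: `¬ 2^{e+4} ∣ ℓ² − 1` (with
`ℓ² − 1 ≠ 0`) gives `v₂(ℓ² − 1) − 3 ≤ e`, hence `min j' (v₂(ℓ² − 1) − 3) ≤ min j' e`. [folklore] -/
theorem padicValNat_sq_sub_one_sub_three_le {ℓ e : ℕ} (hℓ : ℓ ^ 2 - 1 ≠ 0)
    (he : ¬ 2 ^ (e + 4) ∣ ℓ ^ 2 - 1) : padicValNat 2 (ℓ ^ 2 - 1) - 3 ≤ e := by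
  haveI : Fact (Nat.Prime 2) := ⟨Nat.prime_two⟩
  have h : ¬ e + 4 ≤ padicValNat 2 (ℓ ^ 2 - 1) := fun h' ↦ he ((padicValNat_dvd_iff_le hℓ).mpr h')
  omega

end Valuations

section Curve

variable (W : WeierstrassCurve ℚ) [W.IsElliptic] [W.IsGloballyMinimal]

/-- **The GAP certificate, every kernel-side datum decidable.** As `towerGapAtTwo_of_layerSelmer_nat`
(part 8) with: the sharp exponent replaced by `2^{min(j', e_ℓ)}` for a certificate `e : ℕ → ℕ` with
`he : ¬ 2^{e_ℓ+4} ∣ ℓ² − 1` on `P`; and the `C_ℓ = 1` clause for a multiplicative `ℓ` certified by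
`ℓ^{k_ℓ} ∣ Δ_min`, `ℓ^{k_ℓ+1} ∤ Δ_min`, `2 ∤ k_ℓ` for a certificate `k : ℕ → ℕ`. Arithmetic:
`2^d · 4 · ∏_{ℓ ∈ P} C_ℓ^{2^{min(j', e_ℓ)}} < 2^{2^{j'} − 2^j + a}`.
[cite: GreenbergLNM1716, §3 Lemmas 3.3–3.5 (PDF pp. 86–90), Prop. 2.5] [cite: SilvermanAEC2009, VII.1 Prop. 1.3, VII.5.1] -/
theorem towerGapAtTwo_of_layerSelmer_cert
    (h33g : lemma33_localTowerKerPrimary_eq_bot_of_good.{0})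
    (hM : lemma33_localTowerKerPrimary_cyclic_of_multiplicative.{0})
    (hA : lemma33_natCard_localTowerKerPrimary_le_four_of_additive.{0})
    (hS34 : lemma34_localTowerKerPrimary_cyclicExtension_rat)
    (hgo : GoodOrd W 2) (htors : ¬ 2 ∣ W.torsionOrder) {j j' a d : ℕ} (hjj' : j ≤ j')
    (P : Finset ℕ) (hP : ∀ ℓ ∈ P, ℓ.Prime ∧ ℓ ≠ 2)
    (hΔ : ∀ ℓ : ℕ, ℓ.Prime → ℓ ≠ 2 → (ℓ : ℤ) ∣ W.minimalDiscriminantInt → ℓ ∈ P)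
    (C e k : ℕ → ℕ) (he : ∀ ℓ ∈ P, ¬ 2 ^ (e ℓ + 4) ∣ ℓ ^ 2 - 1)
    (hC : ∀ (ℓ : ℕ) [Fact ℓ.Prime], ℓ ∈ P →
      4 ≤ C ℓ ∨ (W.HasMultiplicativeReductionAtPrime ℓ ∧ 2 ≤ C ℓ) ∨
        (W.HasMultiplicativeReductionAtPrime ℓ ∧ (ℓ : ℤ) ^ k ℓ ∣ W.minimalDiscriminantInt ∧
          ¬ (ℓ : ℤ) ^ (k ℓ + 1) ∣ W.minimalDiscriminantInt ∧ ¬ 2 ∣ k ℓ ∧ 1 ≤ C ℓ) ∨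
        (¬ (ℓ : ℤ) ∣ W.minimalDiscriminantInt ∧ 1 ≤ C ℓ))
    (hlow : ∀ κ : ZpExtension ℚ 2, κ.IsCyclotomic →
      2 ^ a ≤ Nat.card {z : W.selmerLayer κ j // 2 • z = 0})
    (hup : ∀ κ : ZpExtension ℚ 2, κ.IsCyclotomic →
      Nat.card {z : W.selmerLayer κ j' // 2 • z = 0} ≤ 2 ^ d)
    (harith : 2 ^ d * 4 * ∏ ℓ ∈ P, C ℓ ^ 2 ^ min j' (e ℓ) < 2 ^ (2 ^ j' - 2 ^ j + a)) :
    TowerGapAtTwo W := by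
  -- `1 ≤ C ℓ` on `P`
  have hC1 : ∀ ℓ ∈ P, 1 ≤ C ℓ := by
    intro ℓ hℓ
    haveI : Fact ℓ.Prime := ⟨(hP ℓ hℓ).1⟩
    rcases hC ℓ hℓ with h | ⟨-, h⟩ | ⟨-, -, -, -, h⟩ | ⟨-, h⟩ <;> omega
  refine towerGapAtTwo_of_layerSelmer_nat W h33g hM hA hS34 hgo htors hjj' P hP hΔ C
    (fun ℓ _ hℓ ↦ ?_) hlow hup (lt_of_le_of_lt ?_ harith)
  · rcases hC ℓ hℓ with h | h | ⟨hm, h1, h2, hodd, hC'⟩ | h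
    · exact Or.inl h
    · exact Or.inr (Or.inl h)
    · refine Or.inr (Or.inr (Or.inl ⟨hm, ?_, hC'⟩))
      rwa [padicValInt_eq_of_dvd_of_not_dvd h1 h2]
    · exact Or.inr (Or.inr (Or.inr h))
  · refine Nat.mul_le_mul_left _ (Finset.prod_le_prod (fun ℓ _ ↦ Nat.zero_le _) fun ℓ hℓ ↦ ?_)
    refine Nat.pow_le_pow_right (hC1 ℓ hℓ) (Nat.pow_le_pow_right (by norm_num) ?_)
    have hℓ2 : ℓ ^ 2 - 1 ≠ 0 := by
      have h3 : 2 ≤ ℓ := (hP ℓ hℓ).1.two_le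
      have : 4 ≤ ℓ ^ 2 := by nlinarith
      omega
    exact min_le_min_left _ (padicValNat_sq_sub_one_sub_three_le hℓ2 (he ℓ hℓ))

/-! ### Doors -/

/-- **Door (`Ш`-currency, decidable certificates) for `BSD(E,2)` at analytic rank `0`** on a
good-ordinary-at-`2` curve with odd torsion order. PRINT (named facts): `hmod`, `hGZK`, `h17`, `hEC`,
`h33g`, `hM`, `hA`, `hS34`. CERTIFICATES: `hper₀`; `P`/`hP`/`hΔ`; `C`, `e`, `k` with `he`, `hC`; layer
Selmer counts `hlow`/`hup`; the closed arithmetic; `MissingLowerBoundAt W 2`.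
[cite: GreenbergLNM1716, Thm. 4.1 (p. 102), §3 Lemmas 3.3–3.5, Prop. 2.5] [cite: Kato2004Asterisque, Thm. 17.4 (1)(2) (p. 273)]
[cite: Miller2011LMS, Def. 1.1] -/
theorem bsdp_two_of_layerSelmer_cert_of_missingLowerBoundAt
    (hmod : nonempty_modularParametrizationData) (hGZK : rank_eq_analyticRank_of_analyticRank_le_one)
    (h17 : ∀ [NeZero (W.conductorNorm ℤ)] (f : CuspForm (Gamma0 (W.conductorNorm ℤ)) 2),
      kato_divisibility_allPrimes W 2 (f := f))
    (hEC : TwoAdicEulerCharRankZero W 0)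
    (h33g : lemma33_localTowerKerPrimary_eq_bot_of_good.{0})
    (hM : lemma33_localTowerKerPrimary_cyclic_of_multiplicative.{0})
    (hA : lemma33_natCard_localTowerKerPrimary_le_four_of_additive.{0})
    (hS34 : lemma34_localTowerKerPrimary_cyclicExtension_rat)
    (hper₀ : ∀ [NeZero (W.conductorNorm ℤ)] (f : CuspForm (Gamma0 (W.conductorNorm ℤ)) 2),
      IsNewformOf W f → ∀ ϖ : ℚ, (ϖ : ℝ) * W.realPeriodRat = plusPeriod f → 0 ≤ padicValRat 2 ϖ)
    (hgo : GoodOrd W 2) (hr : W.analyticRank = 0) (htors : ¬ 2 ∣ W.torsionOrder) {j j' a d : ℕ}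
    (hjj' : j ≤ j') (P : Finset ℕ) (hP : ∀ ℓ ∈ P, ℓ.Prime ∧ ℓ ≠ 2)
    (hΔ : ∀ ℓ : ℕ, ℓ.Prime → ℓ ≠ 2 → (ℓ : ℤ) ∣ W.minimalDiscriminantInt → ℓ ∈ P)
    (C e k : ℕ → ℕ) (he : ∀ ℓ ∈ P, ¬ 2 ^ (e ℓ + 4) ∣ ℓ ^ 2 - 1)
    (hC : ∀ (ℓ : ℕ) [Fact ℓ.Prime], ℓ ∈ P →
      4 ≤ C ℓ ∨ (W.HasMultiplicativeReductionAtPrime ℓ ∧ 2 ≤ C ℓ) ∨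
        (W.HasMultiplicativeReductionAtPrime ℓ ∧ (ℓ : ℤ) ^ k ℓ ∣ W.minimalDiscriminantInt ∧
          ¬ (ℓ : ℤ) ^ (k ℓ + 1) ∣ W.minimalDiscriminantInt ∧ ¬ 2 ∣ k ℓ ∧ 1 ≤ C ℓ) ∨
        (¬ (ℓ : ℤ) ∣ W.minimalDiscriminantInt ∧ 1 ≤ C ℓ))
    (hlow : ∀ κ : ZpExtension ℚ 2, κ.IsCyclotomic →
      2 ^ a ≤ Nat.card {z : W.selmerLayer κ j // 2 • z = 0})
    (hup : ∀ κ : ZpExtension ℚ 2, κ.IsCyclotomic →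
      Nat.card {z : W.selmerLayer κ j' // 2 • z = 0} ≤ 2 ^ d)
    (harith : 2 ^ d * 4 * ∏ ℓ ∈ P, C ℓ ^ 2 ^ min j' (e ℓ) < 2 ^ (2 ^ j' - 2 ^ j + a))
    (hsha : MissingLowerBoundAt W 2) : BSDp W 2 :=
  EisensteinShaCurrency.bsdp_two_of_towerGap_of_missingLowerBoundAt W h17 hper₀ hEC hGZK hmod hgo hr
    (towerGapAtTwo_of_layerSelmer_cert W h33g hM hA hS34 hgo htors hjj' P hP hΔ C e k he hC hlow hup
      harith) hsha

/-- **Door (`Ш`-currency, decidable certificates): `MazurMainConjecture W 2`** at a rank-`0`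
good-ordinary `W` with odd torsion order — in particular the item `OrdKatoHalfAtTwo` AT `W`.
[cite: Kato2004Asterisque, Thm. 17.4 (1)(2) (p. 273)] [cite: GreenbergLNM1716, Thm. 4.1 (p. 102), §3 Lemmas 3.3–3.5, Prop. 2.5] -/
theorem mazurMainConjecture_two_of_layerSelmer_cert_of_missingLowerBoundAt
    (hmod : nonempty_modularParametrizationData) (hGZK : rank_eq_analyticRank_of_analyticRank_le_one)
    (h17 : ∀ [NeZero (W.conductorNorm ℤ)] (f : CuspForm (Gamma0 (W.conductorNorm ℤ)) 2),
      kato_divisibility_allPrimes W 2 (f := f))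
    (hEC : TwoAdicEulerCharRankZero W 0)
    (h33g : lemma33_localTowerKerPrimary_eq_bot_of_good.{0})
    (hM : lemma33_localTowerKerPrimary_cyclic_of_multiplicative.{0})
    (hA : lemma33_natCard_localTowerKerPrimary_le_four_of_additive.{0})
    (hS34 : lemma34_localTowerKerPrimary_cyclicExtension_rat)
    (hper₀ : ∀ [NeZero (W.conductorNorm ℤ)] (f : CuspForm (Gamma0 (W.conductorNorm ℤ)) 2),
      IsNewformOf W f → ∀ ϖ : ℚ, (ϖ : ℝ) * W.realPeriodRat = plusPeriod f → 0 ≤ padicValRat 2 ϖ)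
    (hgo : GoodOrd W 2) (hr : W.analyticRank = 0) (htors : ¬ 2 ∣ W.torsionOrder) {j j' a d : ℕ}
    (hjj' : j ≤ j') (P : Finset ℕ) (hP : ∀ ℓ ∈ P, ℓ.Prime ∧ ℓ ≠ 2)
    (hΔ : ∀ ℓ : ℕ, ℓ.Prime → ℓ ≠ 2 → (ℓ : ℤ) ∣ W.minimalDiscriminantInt → ℓ ∈ P)
    (C e k : ℕ → ℕ) (he : ∀ ℓ ∈ P, ¬ 2 ^ (e ℓ + 4) ∣ ℓ ^ 2 - 1)
    (hC : ∀ (ℓ : ℕ) [Fact ℓ.Prime], ℓ ∈ P →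
      4 ≤ C ℓ ∨ (W.HasMultiplicativeReductionAtPrime ℓ ∧ 2 ≤ C ℓ) ∨
        (W.HasMultiplicativeReductionAtPrime ℓ ∧ (ℓ : ℤ) ^ k ℓ ∣ W.minimalDiscriminantInt ∧
          ¬ (ℓ : ℤ) ^ (k ℓ + 1) ∣ W.minimalDiscriminantInt ∧ ¬ 2 ∣ k ℓ ∧ 1 ≤ C ℓ) ∨
        (¬ (ℓ : ℤ) ∣ W.minimalDiscriminantInt ∧ 1 ≤ C ℓ))
    (hlow : ∀ κ : ZpExtension ℚ 2, κ.IsCyclotomic →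
      2 ^ a ≤ Nat.card {z : W.selmerLayer κ j // 2 • z = 0})
    (hup : ∀ κ : ZpExtension ℚ 2, κ.IsCyclotomic →
      Nat.card {z : W.selmerLayer κ j' // 2 • z = 0} ≤ 2 ^ d)
    (harith : 2 ^ d * 4 * ∏ ℓ ∈ P, C ℓ ^ 2 ^ min j' (e ℓ) < 2 ^ (2 ^ j' - 2 ^ j + a))
    (hsha : MissingLowerBoundAt W 2) : MazurMainConjecture W 2 :=
  EisensteinShaCurrency.mazurMainConjecture_two_of_towerGap_of_missingLowerBoundAt W h17 hper₀ hEC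
    hGZK hmod hgo hr
    (towerGapAtTwo_of_layerSelmer_cert W h33g hM hA hS34 hgo htors hjj' P hP hΔ C e k he hC hlow hup
      harith) hsha

/-- **The Kato–Néron half (the item `OrdKatoHalfAtTwo` AT `W`), `λ`-road, decidable certificates**,
any analytic rank, odd torsion order. [cite: Kato2004Asterisque, Thm. 17.4 (1)(2) (p. 273)]
[cite: GreenbergLNM1716, Prop. 4.14, §3 Lemmas 3.3–3.5, Prop. 2.5] -/
theorem katoHalfAt_two_of_layerSelmer_cert
    (h17 : ∀ [NeZero (W.conductorNorm ℤ)] (f : CuspForm (Gamma0 (W.conductorNorm ℤ)) 2),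
      kato_divisibility_allPrimes W 2 (f := f))
    (h414 : prop414_noFiniteSubmodule_of_not_dvd_torsionOrder)
    (h33g : lemma33_localTowerKerPrimary_eq_bot_of_good.{0})
    (hM : lemma33_localTowerKerPrimary_cyclic_of_multiplicative.{0})
    (hA : lemma33_natCard_localTowerKerPrimary_le_four_of_additive.{0})
    (hS34 : lemma34_localTowerKerPrimary_cyclicExtension_rat)
    (hper₀ : ∀ [NeZero (W.conductorNorm ℤ)] (f : CuspForm (Gamma0 (W.conductorNorm ℤ)) 2),
      IsNewformOf W f → ∀ ϖ : ℚ, (ϖ : ℝ) * W.realPeriodRat = plusPeriod f → 0 ≤ padicValRat 2 ϖ)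
    (hgo : GoodOrd W 2) (htors : ¬ 2 ∣ W.torsionOrder) {n j₀ j j' a d : ℕ}
    (hrank : ∀ κ : ZpExtension ℚ 2, κ.IsCyclotomic →
      2 ^ n ≤ Nat.card {z : W.selmerLayer κ j₀ // 2 • z = 0})
    (hjj' : j ≤ j') (P : Finset ℕ) (hP : ∀ ℓ ∈ P, ℓ.Prime ∧ ℓ ≠ 2)
    (hΔ : ∀ ℓ : ℕ, ℓ.Prime → ℓ ≠ 2 → (ℓ : ℤ) ∣ W.minimalDiscriminantInt → ℓ ∈ P)
    (C e k : ℕ → ℕ) (he : ∀ ℓ ∈ P, ¬ 2 ^ (e ℓ + 4) ∣ ℓ ^ 2 - 1)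
    (hC : ∀ (ℓ : ℕ) [Fact ℓ.Prime], ℓ ∈ P →
      4 ≤ C ℓ ∨ (W.HasMultiplicativeReductionAtPrime ℓ ∧ 2 ≤ C ℓ) ∨
        (W.HasMultiplicativeReductionAtPrime ℓ ∧ (ℓ : ℤ) ^ k ℓ ∣ W.minimalDiscriminantInt ∧
          ¬ (ℓ : ℤ) ^ (k ℓ + 1) ∣ W.minimalDiscriminantInt ∧ ¬ 2 ∣ k ℓ ∧ 1 ≤ C ℓ) ∨
        (¬ (ℓ : ℤ) ∣ W.minimalDiscriminantInt ∧ 1 ≤ C ℓ))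
    (hlow : ∀ κ : ZpExtension ℚ 2, κ.IsCyclotomic →
      2 ^ a ≤ Nat.card {z : W.selmerLayer κ j // 2 • z = 0})
    (hup : ∀ κ : ZpExtension ℚ 2, κ.IsCyclotomic →
      Nat.card {z : W.selmerLayer κ j' // 2 • z = 0} ≤ 2 ^ d)
    (harith : 2 ^ d * 4 * ∏ ℓ ∈ P, C ℓ ^ 2 ^ min j' (e ℓ) < 2 ^ (2 ^ j' - 2 ^ j + a))
    (hlan : AnalyticLambdaEq W 2 n) (hμan : AnalyticMuLE W 2 0) :
    MainConjectureLowerDivisibilityAtTwoOrd W :=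
  katoHalfAt_two_of_towerGap_of_layerSelmer W h17 h414 hper₀ hgo htors
    (towerGapAtTwo_of_layerSelmer_cert W h33g hM hA hS34 hgo htors hjj' P hP hΔ C e k he hC hlow hup
      harith) hrank hlan hμan

end Curve

end Summit.BirchSwinnertonDyer.BirchSwinnertonDyer.Theorems.KatoHalfPinch

end
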